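import Mathlib.Analysis.Calculus.BumpFunction.InnerProduct
import Mathlib.Analysis.Calculus.BumpFunction.Normed
import Mathlib.Analysis.Calculus.ContDiff.Deriv
import Mathlib.MeasureTheory.Integral.IntervalIntegral.Periodic
import Mathlib.MeasureTheory.Integral.IntervalIntegral.FundThmCalculus
import Mathlib.MeasureTheory.Integral.IntervalIntegral.IntegrationByParts
import Mathlib.Analysis.SpecialFunctions.Pow.Real
import Mathlib.Analysis.SpecialFunctions.Pow.Continuity
import Mathlib.Analysis.SpecialFunctions.Sqrt
import Literature.Analysis.FunctionSpaces.TorusTimePeriodization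
import HarnessLib

/-!
# Intermittent time profiles `g_κ`, `h_κ` of space–time convex integration (Cheskidov–Luo 2022, §4.2)

A. Cheskidov, X. Luo, *Sharp nonuniqueness for the Navier–Stokes equations*, Invent. Math. 229
(2022) = arXiv:2009.06596, §4.2 "Implementation of temporal concentration": from a bump
`g ∈ C_c^∞((0,1))` with `∫₀¹ g² = 1` one forms, for a (large) concentration parameter `κ`,

* `g_κ` = the `1`-periodic extension of `κ^{1/2} g(κt)|_{[0,1]}`, so that
  `‖g_κ‖_{L^p([0,1])} ≲ κ^{1/2 - 1/p}` for all `1 ≤ p ≤ ∞` ((4.7)/(4.10)) and `∫₀¹ g_κ² = 1`;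
* `h_κ(t) = ∫₀ᵗ (g_κ² - 1)`, `1`-periodic with `‖h_κ‖_∞ ≤ 1` ((4.8), (4.9)); and for the
  oscillation parameter `ν`, `∂ₜ(ν⁻¹ h_κ(νt)) = g_κ²(νt) - 1` ((4.11)),

the factors that make the Mikado amplitudes `a_k = θ g_κ(νt) ρ^{1/2} Γ_k(Id - R̄/ρ)` ((4.12))
intermittent in time and define the temporal corrector `w^{(t)}` ((4.15)). Everything here is
PROVED (elementary real analysis; no named facts), in a form indexed for use with SEVERAL bumps
of pairwise disjoint supports (one per Mikado direction — the device of Cheskidov–Luo's `L²`-critical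
2D paper that removes the interactions between different directions; with a single bump it is
verbatim §4.2):

* `Intermittent.IsBump g` — `g ∈ C^∞(ℝ)` with `tsupport g ⊆ [lo, hi] ⊂ (0, 1)`; closed under
  `deriv`, products, constants; `Intermittent.exists_isBump_disjoint` — on every finite index type
  there are bumps with pairwise disjoint supports and `∫₀¹ g_i² = 1` (normalised `ContDiffBump`s in
  slots of width `1/n`);
* `Intermittent.profile κ g = g_κ` (via the accepted `timePeriodize 0 1`), smooth for `κ ≥ 1`
  (`IsBump.contDiff_profile`), `1`-periodic, `(g_κ)' = κ (g')_κ` (`IsBump.hasDerivAt_profile`),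
  `∫₀¹ g_κ² = ∫₀¹ g²` (`IsBump.intervalIntegral_profile_sq`), the exact `L^p` scaling
  `∫₀¹ |g_κ|^p = κ^{p/2-1} ∫₀¹ |g|^p`, `p > 0` (`IsBump.intervalIntegral_abs_profile_rpow`),
  `|g_κ| ≤ κ^{1/2} sup|g|`, and disjointness of `g_κ`, `g̃_κ` for disjoint `g`, `g̃`;
* `Intermittent.prim κ g = h_κ`: `h_κ' = g_κ² - 1`, smooth, `1`-periodic when `∫₀¹ g² = 1`, and
  `|h_κ| ≤ 1` (`IsBump.abs_prim_le`);
* the oscillated factors `Intermittent.oscProfile ν κ g (t) = g_κ(νt)` and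
  `Intermittent.oscPrim ν κ g (t) = ν⁻¹ h_κ(νt)` with `∂ₜ(ν⁻¹h_κ(νt)) = g_κ(νt)² - 1`
  (`IsBump.hasDerivAt_oscPrim`), `|ν⁻¹ h_κ(νt)| ≤ ν⁻¹`, the `L^p(0,T)` bound
  `∫₀ᵀ |g_κ(νt)|^p ≤ (T+1) κ^{p/2-1} ∫₀¹|g|^p` for `ν, κ ≥ 1`
  (`IsBump.intervalIntegral_abs_oscProfile_rpow_le`), and the integration-by-parts bound
  `|∫₀ᵀ (g_κ(νt)² - 1) Θ| ≤ ν⁻¹ (|Θ(0)| + |Θ(T)| + ∫₀ᵀ|Θ'|)` for `Θ ∈ C¹([0,T])`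
  (`IsBump.abs_intervalIntegral_oscProfile_sq_sub_one_mul_le`) — the temporal decorrelation step
  of CL22, proof of Prop. 5.3, (5.8), here by parts instead of the improved Hölder inequality.

Part of the decomposition of the convex-integration step `Torus.CheskidovLuo2022ConvexIntegration`
(CL22, Prop. 4.1) recorded in `Literature.Analysis.FluidPDE.NavierStokesReynoldsSteps`.

## Mathlib / tree search

Mathlib (this pin) has `ContDiffBump` (smooth bumps with prescribed radii), periodic interval
integrals (`Function.Periodic.intervalIntegral_add_eq`, `…_add_zsmul_eq`), FTC
(`Continuous.integral_hasStrictDerivAt`), `contDiff_infty_iff_deriv`, and integration by parts with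
one-sided derivatives (`intervalIntegral.integral_mul_deriv_eq_deriv_mul_of_hasDerivWithinAt`);
no periodic extension of a window function with smoothness — that is the tree's
`Literature.Analysis.FunctionSpaces.timePeriodize` (`eventually_timePeriodize_eq_translate`,
`timePeriodize_eq_self_of_mem_Icc`, `intervalIntegral_comp_timePeriodize`), reused here.

## References

* A. Cheskidov, X. Luo, Invent. Math. 229 (2022) = arXiv:2009.06596, §4.2 ((4.7)–(4.11)),
  §4.4 (4.12), (4.15), proof of Prop. 5.3 (5.8). [`CheskidovLuo2022`]
-/

noncomputable section

open Set Filter Topology Function MeasureTheory intervalIntegral Metric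
open scoped ContDiff

namespace Literature.Analysis.FluidPDE

namespace Intermittent

/-! ## Bumps in the open unit window -/

/-- A **bump in the open unit window**: a smooth real function on `ℝ` whose topological support
lies in a compact sub-interval `[lo, hi] ⊂ (0, 1)` (CL22, §4.2: "`g ∈ C_c^∞([0,1])`"; the support
is taken strictly inside so that the periodic extension is smooth). [cite: CheskidovLuo2022, §4.2] -/
structure IsBump (g : ℝ → ℝ) : Prop where
  /-- `g` is `C^∞` on `ℝ`. -/
  smooth : ContDiff ℝ ∞ g
  /-- `tsupport g ⊆ [lo, hi]` for some `0 < lo`, `hi < 1`. -/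
  exists_Icc : ∃ lo hi : ℝ, 0 < lo ∧ hi < 1 ∧ tsupport g ⊆ Icc lo hi

namespace IsBump

variable {g g₁ g₂ : ℝ → ℝ}

/-- A bump vanishes off a compact sub-interval of `(0, 1)`. [folklore] -/
theorem eq_zero (hg : IsBump g) : ∃ lo hi : ℝ, 0 < lo ∧ hi < 1 ∧ ∀ s, s ∉ Icc lo hi → g s = 0 := by
  obtain ⟨lo, hi, hlo, hhi, hsub⟩ := hg.exists_Icc
  exact ⟨lo, hi, hlo, hhi, fun s hs => image_eq_zero_of_notMem_tsupport fun h => hs (hsub h)⟩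

/-- A bump vanishes on `(-∞, 0]`. [folklore] -/
theorem eq_zero_of_le_zero (hg : IsBump g) {s : ℝ} (hs : s ≤ 0) : g s = 0 := by
  obtain ⟨lo, hi, hlo, -, h⟩ := hg.eq_zero
  exact h s fun hm => by linarith [hm.1]

/-- A bump vanishes on `[1, ∞)`. [folklore] -/
theorem eq_zero_of_one_le (hg : IsBump g) {s : ℝ} (hs : 1 ≤ s) : g s = 0 := by
  obtain ⟨lo, hi, -, hhi, h⟩ := hg.eq_zero
  exact h s fun hm => by linarith [hm.2]

/-- Bumps are continuous. [folklore] -/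
protected theorem continuous (hg : IsBump g) : Continuous g := hg.smooth.continuous

/-- The derivative of a bump is a bump. [folklore] -/
protected theorem deriv (hg : IsBump g) : IsBump (deriv g) := by
  obtain ⟨lo, hi, hlo, hhi, hsub⟩ := hg.exists_Icc
  exact ⟨hg.smooth.deriv', lo, hi, hlo, hhi, (tsupport_deriv_subset (f := g)).trans hsub⟩

/-- Constant multiples of bumps are bumps. [folklore] -/
protected theorem const_mul (hg : IsBump g) (c : ℝ) : IsBump fun s => c * g s := by
  obtain ⟨lo, hi, hlo, hhi, hsub⟩ := hg.exists_Icc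
  refine ⟨contDiff_const.mul hg.smooth, lo, hi, hlo, hhi, ?_⟩
  exact (tsupport_mul_subset_right (f := fun _ => c) (g := g)).trans hsub

/-- Products with a bump are bumps. [folklore] -/
protected theorem mul (hg₁ : IsBump g₁) (hg₂ : IsBump g₂) : IsBump fun s => g₁ s * g₂ s := by
  obtain ⟨lo, hi, hlo, hhi, hsub⟩ := hg₂.exists_Icc
  exact ⟨hg₁.smooth.mul hg₂.smooth, lo, hi, hlo, hhi, (tsupport_mul_subset_right (f := g₁) (g := g₂)).trans hsub⟩

/-- Squares of bumps are bumps. [folklore] -/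
protected theorem sq (hg : IsBump g) : IsBump fun s => g s ^ 2 := by
  have h : (fun s => g s ^ 2) = fun s => g s * g s := funext fun s => pow_two (g s)
  rw [h]
  exact hg.mul hg

/-- Bumps are bounded. [folklore] -/
theorem exists_bound (hg : IsBump g) : ∃ B : ℝ, 0 ≤ B ∧ ∀ s, |g s| ≤ B := by
  obtain ⟨lo, hi, -, -, hsub⟩ := hg.exists_Icc
  have hc : HasCompactSupport g := HasCompactSupport.of_support_subset_isCompact isCompact_Icc
    ((subset_tsupport g).trans hsub)
  obtain ⟨B, hB⟩ := hc.exists_bound_of_continuous hg.continuous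
  exact ⟨max B 0, le_max_right _ _, fun s => (Real.norm_eq_abs _ ▸ hB s).trans (le_max_left _ _)⟩

/-- Bumps are interval integrable. [folklore] -/
theorem intervalIntegrable (hg : IsBump g) (a b : ℝ) : IntervalIntegrable g volume a b :=
  hg.continuous.intervalIntegrable a b

end IsBump



/-- If `f` is continuous and vanishes on `[1, ∞)`, its integrals over `[0, c]`, `c ≥ 1`, are its
integral over `[0, 1]`. [folklore] -/
theorem intervalIntegral_eq_of_eq_zero_of_one_le {f : ℝ → ℝ} (hf : Continuous f)
    (h0 : ∀ s, 1 ≤ s → f s = 0) {c : ℝ} (hc : 1 ≤ c) :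
    ∫ s in (0 : ℝ)..c, f s = ∫ s in (0 : ℝ)..1, f s := by
  rw [← integral_add_adjacent_intervals (hf.intervalIntegrable 0 1) (hf.intervalIntegrable 1 c)]
  have : ∫ s in (1 : ℝ)..c, f s = 0 := by
    rw [integral_of_le hc]
    exact setIntegral_eq_zero_of_forall_eq_zero fun s hs => h0 s hs.1.le
  rw [this, add_zero]



/-- The `κ`-concentrated bump on the window, `s ↦ κ^{1/2} g(κ s)` (CL22, §4.2). [cite: CheskidovLuo2022, §4.2] -/
def rescale (κ : ℝ) (g : ℝ → ℝ) (s : ℝ) : ℝ := Real.sqrt κ * g (κ * s)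

/-- **The intermittent time profile `g_κ`**: the `1`-periodic extension of `κ^{1/2} g(κ·)|_{[0,1]}`
(CL22, §4.2: "define `g_κ : [0,1] → ℝ` as the `1`-periodic extension of `κ^{1/2} g(κt)`"),
realised with the accepted `timePeriodize 0 1`. [cite: CheskidovLuo2022, §4.2] -/
def profile (κ : ℝ) (g : ℝ → ℝ) : ℝ → ℝ := FunctionSpaces.timePeriodize 0 1 (rescale κ g)

variable {g g₁ g₂ : ℝ → ℝ} {κ : ℝ}

/-- Integrals of a bump over `[0, c]`, `c ≥ 1`, are integrals over `[0, 1]`. [folklore] -/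
theorem IsBump.intervalIntegral_eq_of_one_le (hg : IsBump g) {c : ℝ} (hc : 1 ≤ c) :
    ∫ s in (0 : ℝ)..c, g s = ∫ s in (0 : ℝ)..1, g s :=
  intervalIntegral_eq_of_eq_zero_of_one_le hg.continuous (fun _ hs => hg.eq_zero_of_one_le hs) hc

/-- Unfolding `rescale`. [folklore] -/
theorem rescale_apply (κ : ℝ) (g : ℝ → ℝ) (s : ℝ) : rescale κ g s = Real.sqrt κ * g (κ * s) := rfl

/-- The rescaled bump is smooth. [folklore] -/
theorem contDiff_rescale (hg : ContDiff ℝ ∞ g) (κ : ℝ) : ContDiff ℝ ∞ (rescale κ g) :=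
  contDiff_const.mul (hg.comp (contDiff_const.mul contDiff_id))

/-- For `κ ≥ 1` the rescaled bump vanishes off an open sub-window `(b, c)`, `0 ≤ b`, `c < 1`
(namely `b = lo/(2κ)`, `c = (hi+1)/(2κ)` when `tsupport g ⊆ [lo, hi]`). [folklore] -/
theorem IsBump.exists_rescale_eq_zero (hg : IsBump g) (hκ : 1 ≤ κ) :
    ∃ b c : ℝ, 0 ≤ b ∧ c < 1 ∧ ∀ s, s ∉ Ioo b c → rescale κ g s = 0 := by
  obtain ⟨lo, hi, hlo, hhi, hsub⟩ := hg.exists_Icc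
  have hκ0 : 0 < κ := by linarith
  refine ⟨lo / (2 * κ), (hi + 1) / (2 * κ), by positivity, ?_, fun s hs => ?_⟩
  · rw [div_lt_one (by positivity)]; linarith
  · rw [rescale_apply, image_eq_zero_of_notMem_tsupport (f := g) fun h => hs ?_, mul_zero]
    have hm := hsub h
    constructor
    · rw [div_lt_iff₀ (by positivity)]; nlinarith [hm.1]
    · rw [lt_div_iff₀ (by positivity)]; nlinarith [hm.2]

/-- `g_κ` is `1`-periodic. [cite: CheskidovLuo2022, §4.2] -/
theorem profile_periodic (κ : ℝ) (g : ℝ → ℝ) : Periodic (profile κ g) 1 :=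
  FunctionSpaces.periodic_timePeriodize one_pos _

/-- Near every time the profile is a translate of the rescaled bump. [folklore] -/
theorem IsBump.profile_eventuallyEq (hg : IsBump g) (hκ : 1 ≤ κ) (t₀ : ℝ) :
    profile κ g =ᶠ[𝓝 t₀] fun t => rescale κ g (t - ⌊t₀⌋) := by
  obtain ⟨b, c, hb, hc, h0⟩ := hg.exists_rescale_eq_zero hκ
  have h := FunctionSpaces.eventually_timePeriodize_eq_translate (a := 0) (τ := 1) one_pos hb
    (by simpa using hc) h0 t₀
  filter_upwards [h] with t ht
  simpa [profile] using ht

/-- **`g_κ` is smooth** for `κ ≥ 1` (near every time it is a translate of the rescaled bump). [folklore] -/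
theorem IsBump.contDiff_profile (hg : IsBump g) (hκ : 1 ≤ κ) : ContDiff ℝ ∞ (profile κ g) := by
  refine contDiff_iff_contDiffAt.2 fun t₀ => ?_
  refine ContDiffAt.congr_of_eventuallyEq ?_ (hg.profile_eventuallyEq hκ t₀)
  exact ((contDiff_rescale hg.smooth κ).comp (contDiff_id.sub contDiff_const)).contDiffAt

/-- `g_κ` is continuous for `κ ≥ 1`. [folklore] -/
theorem IsBump.continuous_profile (hg : IsBump g) (hκ : 1 ≤ κ) : Continuous (profile κ g) :=
  (hg.contDiff_profile hκ).continuous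

/-- On the closed window `[0, 1]` the profile is the rescaled bump. [folklore] -/
theorem IsBump.profile_eq_rescale (hg : IsBump g) (hκ : 1 ≤ κ) {t : ℝ} (ht : t ∈ Icc (0 : ℝ) 1) :
    profile κ g t = rescale κ g t := by
  obtain ⟨b, c, hb, hc, h0⟩ := hg.exists_rescale_eq_zero hκ
  have := FunctionSpaces.timePeriodize_eq_self_of_mem_Icc (a := 0) (τ := 1) one_pos hb (by simpa using hc) h0
    (t := t) (by simpa using ht)
  simpa [profile] using this

/-- **The derivative of the profile**: `(g_κ)' = κ (g')_κ`. [folklore] -/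
theorem IsBump.hasDerivAt_profile (hg : IsBump g) (hκ : 1 ≤ κ) (t : ℝ) :
    HasDerivAt (profile κ g) (κ * profile κ (deriv g) t) t := by
  have h1 := hg.profile_eventuallyEq hκ t
  have h2 := hg.deriv.profile_eventuallyEq hκ t
  have hg' : HasDerivAt g (deriv g (κ * (t - ⌊t⌋))) (κ * (t - ⌊t⌋)) :=
    (hg.smooth.differentiable (by simp)).differentiableAt.hasDerivAt
  have hinner : HasDerivAt (fun s : ℝ => κ * (s - ⌊t⌋)) κ t := by
    simpa using ((hasDerivAt_id t).sub_const (⌊t⌋ : ℝ)).const_mul κ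
  have hd : HasDerivAt (fun s => rescale κ g (s - ⌊t⌋)) (κ * rescale κ (deriv g) (t - ⌊t⌋)) t :=
    ((hg'.comp t hinner).const_mul (Real.sqrt κ)).congr_deriv (by rw [rescale_apply]; ring)
  rw [h2.eq_of_nhds]
  exact hd.congr_of_eventuallyEq h1

/-- `(g_κ)' = κ (g')_κ` as functions. [folklore] -/
theorem IsBump.deriv_profile (hg : IsBump g) (hκ : 1 ≤ κ) :
    deriv (profile κ g) = fun t => κ * profile κ (deriv g) t :=
  funext fun t => (hg.hasDerivAt_profile hκ t).deriv

/-- Disjointly supported bumps give disjointly supported profiles. [folklore] -/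
theorem profile_mul_profile (h : ∀ s, g₁ s * g₂ s = 0) (κ s : ℝ) : profile κ g₁ s * profile κ g₂ s = 0 := by
  simp only [profile, FunctionSpaces.timePeriodize_apply, rescale_apply]
  rw [mul_mul_mul_comm, h, mul_zero]

/-- Pointwise bound `|g_κ| ≤ κ^{1/2} sup|g|`. [folklore] -/
theorem abs_profile_le {B : ℝ} (hB : ∀ s, |g s| ≤ B) (κ s : ℝ) : |profile κ g s| ≤ Real.sqrt κ * B := by
  simp only [profile, FunctionSpaces.timePeriodize_apply, rescale_apply, abs_mul, abs_of_nonneg (Real.sqrt_nonneg κ)]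
  exact mul_le_mul_of_nonneg_left (hB _) (Real.sqrt_nonneg κ)

/-! ## Window integrals -/

/-- **Unit energy is preserved**: `∫₀¹ g_κ² = ∫₀¹ g²` for `κ ≥ 1`. [cite: CheskidovLuo2022, §4.2] -/
theorem IsBump.intervalIntegral_profile_sq (hg : IsBump g) (hκ : 1 ≤ κ) :
    ∫ s in (0 : ℝ)..1, profile κ g s ^ 2 = ∫ s in (0 : ℝ)..1, g s ^ 2 := by
  have hκ0 : 0 < κ := by linarith
  have h1 : ∫ s in (0 : ℝ)..1, profile κ g s ^ 2 = ∫ s in (0 : ℝ)..1, rescale κ g s ^ 2 := by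
    have := FunctionSpaces.intervalIntegral_comp_timePeriodize (a := 0) (τ := 1) one_pos (rescale κ g) (fun x => x ^ 2)
    simpa [profile] using this
  rw [h1]
  simp only [rescale_apply, mul_pow, Real.sq_sqrt hκ0.le]
  rw [intervalIntegral.integral_const_mul, intervalIntegral.integral_comp_mul_left (fun s => g s ^ 2) hκ0.ne',
    mul_zero, mul_one, smul_eq_mul, ← mul_assoc, mul_inv_cancel₀ hκ0.ne', one_mul]
  exact hg.sq.intervalIntegral_eq_of_one_le hκ

/-- **`L^p` scaling on the window**: `∫₀¹ |g_κ|^p = κ^{p/2 - 1} ∫₀¹ |g|^p` (`p > 0`, `κ ≥ 1`), i.e.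
`‖g_κ‖_{L^p([0,1])} = κ^{1/2 - 1/p} ‖g‖_{L^p}`. [cite: CheskidovLuo2022, §4.2 (4.10)] -/
theorem IsBump.intervalIntegral_abs_profile_rpow (hg : IsBump g) (hκ : 1 ≤ κ) {p : ℝ} (hp : 0 < p) :
    ∫ s in (0 : ℝ)..1, |profile κ g s| ^ p = κ ^ (p / 2 - 1) * ∫ s in (0 : ℝ)..1, |g s| ^ p := by
  have hκ0 : 0 < κ := by linarith
  have h1 : ∫ s in (0 : ℝ)..1, |profile κ g s| ^ p = ∫ s in (0 : ℝ)..1, |rescale κ g s| ^ p := by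
    have := FunctionSpaces.intervalIntegral_comp_timePeriodize (a := 0) (τ := 1) one_pos (rescale κ g) (fun x => |x| ^ p)
    simpa [profile] using this
  rw [h1]
  have h2 : ∀ s, |rescale κ g s| ^ p = κ ^ (p / 2) * |g (κ * s)| ^ p := by
    intro s
    rw [rescale_apply, abs_mul, abs_of_nonneg (Real.sqrt_nonneg κ), Real.mul_rpow (Real.sqrt_nonneg κ) (abs_nonneg _)]
    congr 1
    rw [Real.sqrt_eq_rpow, ← Real.rpow_mul hκ0.le]
    congr 1
    ring
  simp_rw [h2]
  rw [intervalIntegral.integral_const_mul, intervalIntegral.integral_comp_mul_left (fun s => |g s| ^ p) hκ0.ne',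
    mul_zero, mul_one, smul_eq_mul, ← mul_assoc]
  have hc : Continuous fun s => |g s| ^ p := hg.continuous.abs.rpow_const fun _ => Or.inr hp.le
  rw [intervalIntegral_eq_of_eq_zero_of_one_le hc (fun s hs => by
      simp only [hg.eq_zero_of_one_le hs, abs_zero, Real.zero_rpow hp.ne']) hκ,
    Real.rpow_sub hκ0, Real.rpow_one]
  ring

variable {ν : ℝ}

/-! ## The periodic primitive `h_κ` -/

/-- **The temporal corrector profile `h_κ(s) = ∫₀ˢ (g_κ² - 1)`** (Cheskidov–Luo 2022, §4.2, (4.8)).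
[cite: CheskidovLuo2022, §4.2] -/
def prim (κ : ℝ) (g : ℝ → ℝ) (s : ℝ) : ℝ := ∫ u in (0 : ℝ)..s, (profile κ g u ^ 2 - 1)

/-- `g_κ² - 1` is continuous. [folklore] -/
theorem IsBump.continuous_profile_sq_sub_one (hg : IsBump g) (hκ : 1 ≤ κ) :
    Continuous fun u => profile κ g u ^ 2 - 1 :=
  ((hg.continuous_profile hκ).pow 2).sub continuous_const

/-- `h_κ' = g_κ² - 1` (fundamental theorem of calculus). [cite: CheskidovLuo2022, §4.2 (4.11)] -/
theorem IsBump.hasDerivAt_prim (hg : IsBump g) (hκ : 1 ≤ κ) (s : ℝ) :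
    HasDerivAt (prim κ g) (profile κ g s ^ 2 - 1) s :=
  ((hg.continuous_profile_sq_sub_one hκ).integral_hasStrictDerivAt 0 s).hasDerivAt

/-- `h_κ' = g_κ² - 1` as functions. [folklore] -/
theorem IsBump.deriv_prim (hg : IsBump g) (hκ : 1 ≤ κ) :
    _root_.deriv (prim κ g) = fun s => profile κ g s ^ 2 - 1 :=
  funext fun s => (hg.hasDerivAt_prim hκ s).deriv

/-- `h_κ` is smooth (primitive of a smooth function). [folklore] -/
theorem IsBump.contDiff_prim (hg : IsBump g) (hκ : 1 ≤ κ) : ContDiff ℝ ∞ (prim κ g) := by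
  rw [contDiff_infty_iff_deriv, hg.deriv_prim hκ]
  exact ⟨fun s => (hg.hasDerivAt_prim hκ s).differentiableAt,
    ((hg.contDiff_profile hκ).pow 2).sub contDiff_const⟩

/-- `h_κ` is continuous. [folklore] -/
theorem IsBump.continuous_prim (hg : IsBump g) (hκ : 1 ≤ κ) : Continuous (prim κ g) :=
  (hg.contDiff_prim hκ).continuous

/-- **`h_κ` is `1`-periodic** when `∫₀¹ g² = 1` (the mean of `g_κ² - 1` over a period vanishes).
[cite: CheskidovLuo2022, §4.2] -/
theorem IsBump.periodic_prim (hg : IsBump g) (hκ : 1 ≤ κ) (h1 : ∫ s in (0 : ℝ)..1, g s ^ 2 = 1) :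
    Periodic (prim κ g) 1 := by
  intro s
  have hc := hg.continuous_profile_sq_sub_one hκ
  have hper : Periodic (fun u => profile κ g u ^ 2 - 1) 1 := fun u => by
    simp only [profile_periodic κ g u]
  have hcont : Continuous fun u => profile κ g u ^ 2 := (hg.continuous_profile hκ).pow 2
  have hmean : ∫ u in (0 : ℝ)..1, (profile κ g u ^ 2 - 1) = 0 := by
    rw [intervalIntegral.integral_sub (hcont.intervalIntegrable 0 1) (by exact _root_.intervalIntegrable_const),
      hg.intervalIntegral_profile_sq hκ, h1]
    simp
  unfold prim
  rw [← integral_add_adjacent_intervals (hc.intervalIntegrable 0 s) (hc.intervalIntegrable s (s + 1)),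
    hper.intervalIntegral_add_eq s 0, zero_add, hmean, add_zero]

/-- **`|h_κ| ≤ 1`** (on `[0,1]`, `h_κ(s) = ∫₀ˢ g_κ² - s` with `0 ≤ ∫₀ˢ g_κ² ≤ 1`; then by
periodicity). [cite: CheskidovLuo2022, §4.2 (4.9)] -/
theorem IsBump.abs_prim_le (hg : IsBump g) (hκ : 1 ≤ κ) (h1 : ∫ s in (0 : ℝ)..1, g s ^ 2 = 1) (s : ℝ) :
    |prim κ g s| ≤ 1 := by
  -- reduce to the window
  have hper := hg.periodic_prim hκ h1
  rw [← hper.sub_int_mul_eq ⌊s⌋, mul_one]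
  set s' : ℝ := s - ⌊s⌋ with hs'
  have hs0 : 0 ≤ s' := by rw [hs']; linarith [Int.floor_le s]
  have hs1 : s' ≤ 1 := by rw [hs']; linarith [Int.lt_floor_add_one s]
  have hcont : Continuous fun u => profile κ g u ^ 2 := (hg.continuous_profile hκ).pow 2
  have hsplit : prim κ g s' = (∫ u in (0 : ℝ)..s', profile κ g u ^ 2) - s' := by
    unfold prim
    rw [intervalIntegral.integral_sub (hcont.intervalIntegrable 0 s') (by exact _root_.intervalIntegrable_const)]
    simp
  have hA0 : 0 ≤ ∫ u in (0 : ℝ)..s', profile κ g u ^ 2 :=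
    intervalIntegral.integral_nonneg hs0 fun u _ => sq_nonneg _
  have hA1 : ∫ u in (0 : ℝ)..s', profile κ g u ^ 2 ≤ 1 := by
    rw [← h1, ← hg.intervalIntegral_profile_sq hκ]
    exact intervalIntegral.integral_mono_interval le_rfl hs0 hs1
      (Eventually.of_forall fun u => sq_nonneg _) (hcont.intervalIntegrable 0 1)
  rw [hsplit, abs_le]
  constructor <;> linarith

/-! ## Oscillation in time: `g_κ(ν t)` and `ν⁻¹ h_κ(ν t)` -/

/-- The time profile oscillated at frequency `ν`: `G(t) = g_κ(ν t)`. [cite: CheskidovLuo2022, §4.4 (4.12)] -/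
def oscProfile (ν κ : ℝ) (g : ℝ → ℝ) (t : ℝ) : ℝ := profile κ g (ν * t)

/-- The temporal corrector factor `H(t) = ν⁻¹ h_κ(ν t)`. [cite: CheskidovLuo2022, §4.2 (4.11)] -/
def oscPrim (ν κ : ℝ) (g : ℝ → ℝ) (t : ℝ) : ℝ := ν⁻¹ * prim κ g (ν * t)

/-- Unfolding `oscProfile`. [folklore] -/
theorem oscProfile_apply (ν κ : ℝ) (g : ℝ → ℝ) (t : ℝ) : oscProfile ν κ g t = profile κ g (ν * t) := rfl

/-- `g_κ(ν·)` is smooth. [folklore] -/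
theorem IsBump.contDiff_oscProfile (hg : IsBump g) (hκ : 1 ≤ κ) (ν : ℝ) : ContDiff ℝ ∞ (oscProfile ν κ g) :=
  (hg.contDiff_profile hκ).comp (contDiff_const.mul contDiff_id)

/-- `g_κ(ν·)` is continuous. [folklore] -/
theorem IsBump.continuous_oscProfile (hg : IsBump g) (hκ : 1 ≤ κ) (ν : ℝ) : Continuous (oscProfile ν κ g) :=
  (hg.contDiff_oscProfile hκ ν).continuous

/-- `G' = ν κ (g')_κ(ν ·)`. [folklore] -/
theorem IsBump.hasDerivAt_oscProfile (hg : IsBump g) (hκ : 1 ≤ κ) (ν t : ℝ) :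
    HasDerivAt (oscProfile ν κ g) (ν * κ * oscProfile ν κ (deriv g) t) t := by
  have h := (hg.hasDerivAt_profile hκ (ν * t)).comp t ((hasDerivAt_id t).const_mul ν)
  refine h.congr_deriv ?_
  simp only [oscProfile_apply, mul_one]
  ring

/-- `(g_κ(ν·))' = ν κ (g')_κ(ν·)` as functions. [folklore] -/
theorem IsBump.deriv_oscProfile (hg : IsBump g) (hκ : 1 ≤ κ) (ν : ℝ) :
    deriv (oscProfile ν κ g) = fun t => ν * κ * oscProfile ν κ (deriv g) t :=
  funext fun t => (hg.hasDerivAt_oscProfile hκ ν t).deriv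

/-- **`∂ₜ(ν⁻¹ h_κ(ν t)) = g_κ²(ν t) - 1`** (Cheskidov–Luo 2022, (4.11)). [cite: CheskidovLuo2022, §4.2 (4.11)] -/
theorem IsBump.hasDerivAt_oscPrim (hg : IsBump g) (hκ : 1 ≤ κ) (hν : ν ≠ 0) (t : ℝ) :
    HasDerivAt (oscPrim ν κ g) (oscProfile ν κ g t ^ 2 - 1) t := by
  have h := ((hg.hasDerivAt_prim hκ (ν * t)).comp t ((hasDerivAt_id t).const_mul ν)).const_mul ν⁻¹
  refine h.congr_deriv ?_
  simp only [oscProfile_apply, mul_one]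
  field_simp

/-- `ν⁻¹ h_κ(ν·)` is smooth. [folklore] -/
theorem IsBump.contDiff_oscPrim (hg : IsBump g) (hκ : 1 ≤ κ) (ν : ℝ) : ContDiff ℝ ∞ (oscPrim ν κ g) :=
  contDiff_const.mul ((hg.contDiff_prim hκ).comp (contDiff_const.mul contDiff_id))

/-- **`|ν⁻¹ h_κ(ν t)| ≤ ν⁻¹`**. [cite: CheskidovLuo2022, §4.2 (4.9)] -/
theorem IsBump.abs_oscPrim_le (hg : IsBump g) (hκ : 1 ≤ κ) (h1 : ∫ s in (0 : ℝ)..1, g s ^ 2 = 1)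
    (hν : 0 < ν) (t : ℝ) : |oscPrim ν κ g t| ≤ ν⁻¹ := by
  rw [oscPrim, abs_mul, abs_of_pos (inv_pos.2 hν)]
  exact mul_le_of_le_one_right (inv_pos.2 hν).le (hg.abs_prim_le hκ h1 _)

/-- Disjointly supported bumps give disjointly supported oscillated profiles. [folklore] -/
theorem oscProfile_mul_oscProfile (h : ∀ s, g₁ s * g₂ s = 0) (ν κ t : ℝ) :
    oscProfile ν κ g₁ t * oscProfile ν κ g₂ t = 0 :=
  profile_mul_profile h κ (ν * t)

/-- Pointwise bound `|G| ≤ κ^{1/2} sup|g|`. [folklore] -/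
theorem abs_oscProfile_le {B : ℝ} (hB : ∀ s, |g s| ≤ B) (ν κ t : ℝ) : |oscProfile ν κ g t| ≤ Real.sqrt κ * B :=
  abs_profile_le hB κ (ν * t)

/-! ## Integral bounds over `[0, T]` -/

/-- Integral of a nonnegative `1`-periodic continuous function over `[0, L]`, `L ≥ 0`, is at most
`(L + 1)` period integrals. [folklore] -/
theorem intervalIntegral_le_of_periodic {F : ℝ → ℝ} (hF : Continuous F) (hper : Periodic F 1)
    (h0 : ∀ u, 0 ≤ F u) {L : ℝ} (hL : 0 ≤ L) :
    ∫ u in (0 : ℝ)..L, F u ≤ (L + 1) * ∫ u in (0 : ℝ)..1, F u := by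
  set m : ℕ := ⌈L⌉₊ with hm
  have hLm : L ≤ m := Nat.le_ceil L
  have hm1 : (m : ℝ) ≤ L + 1 := (Nat.ceil_lt_add_one hL).le
  have hI : 0 ≤ ∫ u in (0 : ℝ)..1, F u := intervalIntegral.integral_nonneg zero_le_one fun u _ => h0 u
  calc ∫ u in (0 : ℝ)..L, F u ≤ ∫ u in (0 : ℝ)..m, F u :=
        intervalIntegral.integral_mono_interval le_rfl hL hLm (Eventually.of_forall h0) (hF.intervalIntegrable _ _)
    _ = m * ∫ u in (0 : ℝ)..1, F u := by
        have := hper.intervalIntegral_add_zsmul_eq m 0 fun _ _ => hF.intervalIntegrable _ _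
        simp only [zero_add, zsmul_eq_mul, Int.cast_natCast] at this
        simpa using this
    _ ≤ (L + 1) * ∫ u in (0 : ℝ)..1, F u := mul_le_mul_of_nonneg_right hm1 hI

/-- **The `L^p(0,T)` bound for the oscillated profile**:
`∫₀ᵀ |g_κ(νt)|^p dt ≤ (T + 1) κ^{p/2 - 1} ∫₀¹ |g|^p` for `ν ≥ 1`, `κ ≥ 1`, `p > 0`, i.e.
`‖g_κ(ν·)‖_{L^p(0,T)} ≲_T κ^{1/2 - 1/p}` (Cheskidov–Luo 2022, (4.10)). [cite: CheskidovLuo2022, §4.2 (4.10)] -/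
theorem IsBump.intervalIntegral_abs_oscProfile_rpow_le (hg : IsBump g) (hκ : 1 ≤ κ) (hν : 1 ≤ ν) {T : ℝ}
    (hT : 0 ≤ T) {p : ℝ} (hp : 0 < p) :
    ∫ t in (0 : ℝ)..T, |oscProfile ν κ g t| ^ p ≤
      (T + 1) * κ ^ (p / 2 - 1) * ∫ s in (0 : ℝ)..1, |g s| ^ p := by
  have hν0 : 0 < ν := by linarith
  have hκ0 : 0 < κ := by linarith
  have hF : Continuous fun u => |profile κ g u| ^ p :=
    (hg.continuous_profile hκ).abs.rpow_const fun _ => Or.inr hp.le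
  have hper : Periodic (fun u => |profile κ g u| ^ p) 1 := fun u => by simp only [profile_periodic κ g u]
  have h0 : ∀ u, 0 ≤ |profile κ g u| ^ p := fun u => Real.rpow_nonneg (abs_nonneg _) _
  -- change variables `u = ν t`
  have h1 : ∫ t in (0 : ℝ)..T, |oscProfile ν κ g t| ^ p = ν⁻¹ * ∫ u in (0 : ℝ)..ν * T, |profile κ g u| ^ p := by
    simp only [oscProfile_apply]
    rw [intervalIntegral.integral_comp_mul_left (fun u => |profile κ g u| ^ p) hν0.ne', mul_zero, smul_eq_mul]
  rw [h1]
  have h2 := intervalIntegral_le_of_periodic hF hper h0 (L := ν * T) (by positivity)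
  rw [hg.intervalIntegral_abs_profile_rpow hκ hp] at h2
  have hI : 0 ≤ ∫ s in (0 : ℝ)..1, |g s| ^ p :=
    intervalIntegral.integral_nonneg zero_le_one fun u _ => Real.rpow_nonneg (abs_nonneg _) _
  calc ν⁻¹ * ∫ u in (0 : ℝ)..ν * T, |profile κ g u| ^ p
      ≤ ν⁻¹ * ((ν * T + 1) * (κ ^ (p / 2 - 1) * ∫ s in (0 : ℝ)..1, |g s| ^ p)) :=
        mul_le_mul_of_nonneg_left h2 (inv_pos.2 hν0).le
    _ = (T + ν⁻¹) * κ ^ (p / 2 - 1) * ∫ s in (0 : ℝ)..1, |g s| ^ p := by field_simp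
    _ ≤ (T + 1) * κ ^ (p / 2 - 1) * ∫ s in (0 : ℝ)..1, |g s| ^ p := by
        have : ν⁻¹ ≤ 1 := inv_le_one_of_one_le₀ hν
        gcongr

/-- **Integration by parts against the oscillating factor `g_κ²(νt) - 1`**: for `Θ` continuously
differentiable within `[0, T]`,
`|∫₀ᵀ (g_κ(νt)² - 1) Θ(t) dt| ≤ ν⁻¹ (|Θ(0)| + |Θ(T)| + ∫₀ᵀ |Θ'|)`
(the primitive `ν⁻¹h_κ(νt)` is bounded by `ν⁻¹`). This is the mechanism of Cheskidov–Luo 2022,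
proof of Prop. 5.3, (5.8) (there via the improved Hölder inequality in time). [cite: CheskidovLuo2022, Prop. 5.3 (5.8)] -/
theorem IsBump.abs_intervalIntegral_oscProfile_sq_sub_one_mul_le (hg : IsBump g) (hκ : 1 ≤ κ) (hν : 1 ≤ ν)
    (h1 : ∫ s in (0 : ℝ)..1, g s ^ 2 = 1) {T : ℝ} (hT : 0 ≤ T) {Θ Θ' : ℝ → ℝ}
    (hΘ : ∀ t ∈ Icc 0 T, HasDerivWithinAt Θ (Θ' t) (Icc 0 T) t) (hΘ' : ContinuousOn Θ' (Icc 0 T)) :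
    |∫ t in (0 : ℝ)..T, (oscProfile ν κ g t ^ 2 - 1) * Θ t| ≤
      ν⁻¹ * (|Θ 0| + |Θ T| + ∫ t in (0 : ℝ)..T, |Θ' t|) := by
  have hν0 : 0 < ν := by linarith
  have hH : ∀ t ∈ uIcc 0 T, HasDerivWithinAt (oscPrim ν κ g) (oscProfile ν κ g t ^ 2 - 1) (uIcc 0 T) t :=
    fun t _ => (hg.hasDerivAt_oscPrim hκ hν0.ne' t).hasDerivWithinAt
  have hΘu : ∀ t ∈ uIcc 0 T, HasDerivWithinAt Θ (Θ' t) (uIcc 0 T) t := by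
    rw [uIcc_of_le hT]; exact hΘ
  have hGi : IntervalIntegrable (fun t => oscProfile ν κ g t ^ 2 - 1) volume 0 T :=
    (((hg.continuous_oscProfile hκ ν).pow 2).sub continuous_const).intervalIntegrable 0 T
  have hΘ'i : IntervalIntegrable Θ' volume 0 T :=
    (hΘ'.mono (by rw [uIcc_of_le hT])).intervalIntegrable
  have hparts := intervalIntegral.integral_mul_deriv_eq_deriv_mul_of_hasDerivWithinAt hΘu hH hΘ'i hGi
  -- `∫ Θ (G² - 1) = Θ T H T - Θ 0 H 0 - ∫ Θ' H`
  have hcomm : ∫ t in (0 : ℝ)..T, (oscProfile ν κ g t ^ 2 - 1) * Θ t =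
      ∫ t in (0 : ℝ)..T, Θ t * (oscProfile ν κ g t ^ 2 - 1) :=
    intervalIntegral.integral_congr fun t _ => mul_comm _ _
  rw [hcomm, hparts]
  have hb := hg.abs_oscPrim_le hκ h1 hν0
  have hint : |∫ t in (0 : ℝ)..T, Θ' t * oscPrim ν κ g t| ≤ ν⁻¹ * ∫ t in (0 : ℝ)..T, |Θ' t| := by
    rw [← intervalIntegral.integral_const_mul]
    refine (intervalIntegral.abs_integral_le_integral_abs hT).trans (intervalIntegral.integral_mono_on hT ?_ ?_ ?_)
    · exact (hΘ'i.mul_continuousOn ((hg.contDiff_oscPrim hκ ν).continuous.continuousOn)).abs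
    · exact hΘ'i.abs.const_mul _
    · intro t _
      rw [abs_mul, mul_comm]
      exact mul_le_mul_of_nonneg_right (hb t) (abs_nonneg _)
  calc |Θ T * oscPrim ν κ g T - Θ 0 * oscPrim ν κ g 0 - ∫ t in (0 : ℝ)..T, Θ' t * oscPrim ν κ g t|
      ≤ |Θ T * oscPrim ν κ g T| + |Θ 0 * oscPrim ν κ g 0| + |∫ t in (0 : ℝ)..T, Θ' t * oscPrim ν κ g t| :=
        (abs_sub _ _).trans (add_le_add_left (abs_sub _ _) _)
    _ ≤ |Θ T| * ν⁻¹ + |Θ 0| * ν⁻¹ + ν⁻¹ * ∫ t in (0 : ℝ)..T, |Θ' t| := by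
        gcongr
        · rw [abs_mul]; exact mul_le_mul_of_nonneg_left (hb T) (abs_nonneg _)
        · rw [abs_mul]; exact mul_le_mul_of_nonneg_left (hb 0) (abs_nonneg _)
    _ = ν⁻¹ * (|Θ 0| + |Θ T| + ∫ t in (0 : ℝ)..T, |Θ' t|) := by ring

/-! ## Existence of finitely many disjointly supported unit bumps -/

/-- The standard bump of `Fin n` slots: centre `(j + 1/2)/n`, radii `1/(8n) < 1/(4n)`. [folklore] -/
def slotBump {n : ℕ} (hn : 0 < n) (j : Fin n) : ContDiffBump (((j : ℝ) + 1 / 2) / n) where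
  rIn := 1 / (8 * n)
  rOut := 1 / (4 * n)
  rIn_pos := by positivity
  rIn_lt_rOut := by
    have : (0 : ℝ) < n := by exact_mod_cast hn
    rw [div_lt_div_iff_of_pos_left one_pos (by positivity) (by positivity)]
    linarith

/-- The slot bumps are bumps in the open unit window: `tsupport = [(j + 1/4)/n, (j + 3/4)/n]`. [folklore] -/
theorem slotBump_isBump {n : ℕ} (hn : 0 < n) (j : Fin n) : IsBump (slotBump hn j) := by
  have hn' : (0 : ℝ) < n := by exact_mod_cast hn
  have hj : ((j : ℕ) : ℝ) + 1 ≤ n := by exact_mod_cast j.2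
  refine ⟨(slotBump hn j).contDiff, ((j : ℝ) + 1 / 4) / n, ((j : ℝ) + 3 / 4) / n, by positivity, ?_, ?_⟩
  · rw [div_lt_one hn']; linarith
  · rw [(slotBump hn j).tsupport_eq, Real.closedBall_eq_Icc]
    refine Icc_subset_Icc (le_of_eq ?_) (le_of_eq ?_) <;>
    · simp only [slotBump]; field_simp; ring

/-- The slot bumps have positive energy `∫₀¹ φ_j² ≥ 2 · 1/(8n)` (they equal `1` on the inner ball). [folklore] -/
theorem slotBump_sq_integral_pos {n : ℕ} (hn : 0 < n) (j : Fin n) :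
    0 < ∫ s in (0 : ℝ)..1, (slotBump hn j) s ^ 2 := by
  have hn' : (0 : ℝ) < n := by exact_mod_cast hn
  have hj : ((j : ℕ) : ℝ) + 1 ≤ n := by exact_mod_cast j.2
  set c : ℝ := ((j : ℝ) + 1 / 2) / n with hc
  set r : ℝ := 1 / (8 * n) with hr
  have hr0 : 0 < r := by positivity
  have hlo : 0 ≤ c - r := by rw [hc, hr]; rw [sub_nonneg, div_le_div_iff₀ (by positivity) hn']; nlinarith
  have hhi : c + r ≤ 1 := by
    rw [hc, hr]
    have : ((j : ℝ) + 1 / 2) / n + 1 / (8 * n) = ((j : ℝ) + 5 / 8) / n := by field_simp; ring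
    rw [this, div_le_one hn']; linarith
  have hcont : Continuous fun s => (slotBump hn j) s ^ 2 := (slotBump hn j).continuous.pow 2
  calc (0 : ℝ) < ∫ _ in (c - r)..(c + r), (1 : ℝ) := by simp [hr0]
    _ = ∫ s in (c - r)..(c + r), (slotBump hn j) s ^ 2 := by
        refine intervalIntegral.integral_congr fun s hs => ?_
        rw [uIcc_of_le (by linarith)] at hs
        have : (slotBump hn j) s = 1 := (slotBump hn j).one_of_mem_closedBall (by
          rw [Real.closedBall_eq_Icc]; exact hs)
        simp [this]
    _ ≤ ∫ s in (0 : ℝ)..1, (slotBump hn j) s ^ 2 :=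
        intervalIntegral.integral_mono_interval hlo (by linarith) hhi (Eventually.of_forall fun s => sq_nonneg _)
          (hcont.intervalIntegrable 0 1)

/-- Distinct slot bumps have disjoint supports (centres `1/n` apart, radii `1/(4n)`). [folklore] -/
theorem slotBump_mul_slotBump {n : ℕ} (hn : 0 < n) {j j' : Fin n} (hjj' : j ≠ j') (s : ℝ) :
    (slotBump hn j) s * (slotBump hn j') s = 0 := by
  have hn' : (0 : ℝ) < n := by exact_mod_cast hn
  by_contra h
  obtain ⟨h1, h2⟩ := mul_ne_zero_iff.mp h
  have m1 : s ∈ Function.support (slotBump hn j : ℝ → ℝ) := h1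
  have m2 : s ∈ Function.support (slotBump hn j' : ℝ → ℝ) := h2
  rw [(slotBump hn j).support_eq, mem_ball, Real.dist_eq] at m1
  rw [(slotBump hn j').support_eq, mem_ball, Real.dist_eq] at m2
  simp only [slotBump] at m1 m2
  -- the centres are at distance `≥ 1/n`
  have hne : (j : ℕ) ≠ (j' : ℕ) := fun h => hjj' (Fin.ext h)
  have hdist : (1 : ℝ) ≤ |((j : ℕ) : ℝ) - ((j' : ℕ) : ℝ)| := by
    rw [← Int.cast_natCast, ← Int.cast_natCast (j' : ℕ), ← Int.cast_sub, ← Int.cast_abs, ← Int.cast_one, Int.cast_le]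
    exact Int.one_le_abs (sub_ne_zero.2 (by exact_mod_cast hne))
  have key : |((j : ℝ) + 1 / 2) / n - ((j' : ℝ) + 1 / 2) / n| < 1 / (2 * n) := by
    calc |((j : ℝ) + 1 / 2) / n - ((j' : ℝ) + 1 / 2) / n|
        ≤ |s - ((j : ℝ) + 1 / 2) / n| + |s - ((j' : ℝ) + 1 / 2) / n| := by
          rw [abs_sub_comm s]; exact abs_sub_le _ _ _
      _ < 1 / (4 * n) + 1 / (4 * n) := add_lt_add m1 m2
      _ = 1 / (2 * n) := by field_simp; ring
  rw [← sub_div, abs_div, abs_of_pos hn', div_lt_div_iff₀ hn' (by positivity)] at key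
  have : |((j : ℝ) + 1 / 2) - ((j' : ℝ) + 1 / 2)| = |((j : ℕ) : ℝ) - ((j' : ℕ) : ℝ)| := by ring_nf
  rw [this] at key
  nlinarith

/-- **Disjoint unit bumps**: on every finite index type there are bumps `g_i ∈ C_c^∞((0,1))` with
pairwise disjoint supports and `∫₀¹ g_i² = 1` (slots of width `1/n`, normalised ContDiffBumps).
These are the time profiles that switch the Mikado directions on one at a time. [folklore] -/
theorem exists_isBump_disjoint (ι : Type*) [Fintype ι] :
    ∃ g : ι → ℝ → ℝ, (∀ i, IsBump (g i)) ∧ (∀ i, ∫ s in (0 : ℝ)..1, g i s ^ 2 = 1) ∧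
      ∀ i i', i ≠ i' → ∀ s, g i s * g i' s = 0 := by
  rcases isEmpty_or_nonempty ι with hι | hι
  · exact ⟨fun _ _ => 0, fun i => isEmptyElim i, fun i => isEmptyElim i, fun i => isEmptyElim i⟩
  set n : ℕ := Fintype.card ι
  have hn : 0 < n := Fintype.card_pos
  set e : ι ≃ Fin n := Fintype.equivFin ι
  set A : Fin n → ℝ := fun j => ∫ s in (0 : ℝ)..1, (slotBump hn j) s ^ 2 with hA
  have hA0 : ∀ j, 0 < A j := fun j => slotBump_sq_integral_pos hn j
  refine ⟨fun i s => (Real.sqrt (A (e i)))⁻¹ * (slotBump hn (e i)) s, fun i => (slotBump_isBump hn (e i)).const_mul _,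
    fun i => ?_, fun i i' hii' s => ?_⟩
  · simp only [mul_pow, intervalIntegral.integral_const_mul]
    rw [inv_pow, Real.sq_sqrt (hA0 _).le]
    exact inv_mul_cancel₀ (hA0 _).ne'
  · rw [mul_mul_mul_comm, slotBump_mul_slotBump hn (fun h => hii' (e.injective h)) s, mul_zero]

end Intermittent

end Literature.Analysis.FluidPDE
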